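import Summits.QuantumFields.GaugeBoot.ClassBLimitCovariantLinkGeometry
import Summits.QuantumFields.GaugeBoot.ClassBIdentification
import Literature.MathematicalPhysics.QuantumFieldTheory.ConstructiveQFTWave0CovariantRPProofs
import HarnessLib

/-!
# Covariant link reflection positivity of torus limit points, every axis (gauge-boot, Class-B brick)

HONEST FRAMING (cell `pub-gaugeboot`, page 1 of every file): the venture produces certified bounds
on lattice expectations at stated coupling, gauge group, dimension and torus size; NOT a mass gap,
NOT a continuum limit, NOT a string tension; NOT Yang–Mills-summit-bearing (barriers
`FixedCouplingUltralocality`, `PerturbativeInvisibility`). Structural: which positivity constraints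
are EXACT for infinite-volume limit points of the torus Wilson states; this module bounds nothing.

## Content

`ClassBLimitLinkRP.lean` proved the PLAIN link reflection positivity (`ClassB.lean`'s `linkRP`)
of every infinite-volume limit point `μ ∈ infiniteVolumeLimitPoints ρ β` (`β ≥ 0`). Here the same
transfer gives the COVARIANT (Osterwalder–Seiler half-link) form `IsCovariantLinkRP i μ` of
`ZdCovariantLinkRP.lean` — the property behind Kazakov–Zheng's link-type positivity matrices
(Wilson paths ending on the hyperplane through the middles of links, arXiv:2203.11360 §3.1):

* `torus_cov_nonneg`: on every torus `(ℤ/L)^d` with `m + 1 ≤ L/2` the lift of a covariant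
  observable supported on `|x_0| ≤ m` has non-negative Wilson expectation (`β ≥ 0`) — the tree's
  `wilsonExpectation_nonneg_of_covariant` (even `L`) and `wilsonExpectation_nonneg_of_oddCovariant`
  (odd `L ≥ 3`) through the intertwining lemmas of `ClassBLimitCovariantLinkGeometry.lean`, so EVERY
  subsequence of torus sizes is covered;
* ★★ **`covariantLinkRP_zero_of_mem_infiniteVolumeLimitPoints`**: `IsCovariantLinkRP 0 μ` for
  every limit point (`β ≥ 0`, continuous `ρ`), by weak convergence along the defining subsequence
  (real and imaginary parts separately, as in `ClassBLimitLinkRP.lean`);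
* `IsCovariantLinkRP.of_swap` — transport under the axis transposition `(0 i)` for a measure it
  preserves — and ★★★ **`covariantLinkRP_of_mem_infiniteVolumeLimitPoints`**: `IsCovariantLinkRP i μ`
  in EVERY axis `i` (limit points are permutation invariant,
  `permInvariant_of_mem_infiniteVolumeLimitPoints`).

Consequence (`ClassBLinkCutWordBlocks.lean`): the Kazakov–Zheng cut-loop `R_link` word blocks are
PSD for every torus limit point. Nothing is claimed for a general `ClassBState` (whose `linkRP`
axiom is the plain form; `IsCovariantLinkRP.linkRP` recovers it from the covariant one).

References: K. Osterwalder, E. Seiler, Ann. Phys. 110 (1978) 440, §2; E. Seiler, LNP 159 (1982)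
Thm. 2.2; V. Kazakov, Z. Zheng, arXiv:2203.11360 §3.1; J. Glimm, A. Jaffe (1987) §6.1.
-/

noncomputable section

open MeasureTheory Filter Topology
open scoped ComplexOrder ComplexConjugate
open Literature.Probability.LatticeModels (Site Torus.proj)
open Literature.MathematicalPhysics.QuantumLattice
open Literature.MathematicalPhysics.QuantumFieldTheory (GaugeConfig Edge wilsonExpectation
  wilsonMeasure isProbabilityMeasure_wilsonMeasure measurable_torusLift
  wilsonExpectation_nonneg_of_covariant wilsonExpectation_nonneg_of_oddCovariant)

namespace Summit.QuantumFields.GaugeBoot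

variable {d N : ℕ} {G : Type*} [Group G] [TopologicalSpace G] [IsTopologicalGroup G]
  [CompactSpace G] [MeasurableSpace G] [BorelSpace G] [NeZero d]
variable (ρ : G →* Matrix (Fin N) (Fin N) ℂ)

/-! ## The torus step and the limit -/

section Limit

/-- **Torus step.** On a torus `(ℤ/L)^d` with `m + 1 ≤ L/2`, the lift of a covariant observable
`Φ` (coefficients `g_k` supported on `linkHalfEdges 0 ∪ linkCrossEdges 0` with `x_0 ≤ m`, `Φ`
supported on `|x_0| ≤ m`) has non-negative Wilson expectation (`β ≥ 0`): even `L` by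
`wilsonExpectation_nonneg_of_covariant`, odd `L ≥ 3` by `wilsonExpectation_nonneg_of_oddCovariant`. -/
theorem torus_cov_nonneg (hρ : Continuous ρ) {β : ℝ} (hβ : 0 ≤ β) {L : ℕ} [NeZero L]
    {n : ℕ} {g : Fin n → LGConfig d G → ℂ} {T : Finset (ZdEdge d)}
    (hT : (↑T : Set (ZdEdge d)) ⊆ linkHalfEdges 0 ∪ linkCrossEdges 0) (hgm : ∀ k, Measurable (g k))
    (hgT : ∀ k, IsCylinder (g k) T) {Cg : ℝ} (hCg : ∀ k U, ‖g k U‖ ≤ Cg)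
    {Φ : LGConfig d G → ℂ} {S : Finset (ZdEdge d)} (hΦS : IsCylinder Φ S) (hΦm : Measurable Φ)
    (hcov : ∀ U Y, Φ (configCrossTranslate 0 Y U) =
      ∑ k, g k (configCrossSplice 0 U Y) * conj (g k (configLinkReflect 0 U)))
    {m : ℕ} (hSm : ∀ e ∈ S, -(m : ℤ) ≤ e.1 0 ∧ e.1 0 ≤ m) (hTm : ∀ e ∈ T, e.1 0 ≤ m)
    (hmL : m + 1 ≤ L / 2) :
    0 ≤ wilsonExpectation ρ β (toTorusObservable L Φ) := by
  have hgm' : ∀ k, Measurable (toTorusObservable L (g k)) := fun k =>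
    (hgm k).comp (measurable_torusLift L)
  have hgb' : ∀ k (U : GaugeConfig d L G), ‖toTorusObservable L (g k) U‖ ≤ Cg := fun k U => hCg k _
  have hΦm' : Measurable (toTorusObservable L Φ) := hΦm.comp (measurable_torusLift L)
  have hTb := bounds_of_subset_half_union_cross hT hTm
  rcases Nat.even_or_odd L with hL | hL
  · refine wilsonExpectation_nonneg_of_covariant ρ hL hρ hβ hgm' hgb'
      (fun k => dependsOn_toTorusObservable_posCross (hgT k) hT hTm hmL) hΦm' fun U Y => ?_
    rw [toTorusObservable_apply, apply_torusLift_translate hΦS hSm hmL, hcov]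
    refine Finset.sum_congr rfl fun k _ => ?_
    rw [toTorusObservable_apply, toTorusObservable_apply, apply_torusLift_splice (hgT k) hTb hmL,
      torusLift_timeReflect]
  · have h3 : 3 ≤ L := by
      obtain ⟨r, hr⟩ := hL
      have := Nat.div_le_self L 2
      omega
    refine wilsonExpectation_nonneg_of_oddCovariant ρ hL h3 hρ hβ hgm' hgb'
      (fun k => dependsOn_toTorusObservable_oddPosCross (hgT k) hT hTm hmL) hΦm' fun U Y => ?_
    rw [toTorusObservable_apply, apply_torusLift_translateLow hΦS hSm hmL, hcov]
    refine Finset.sum_congr rfl fun k _ => ?_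
    rw [toTorusObservable_apply, toTorusObservable_apply, apply_torusLift_spliceLow (hgT k) hTb hmL,
      torusLift_timeReflect]

variable [SecondCountableTopology G]

/-- ★★ **Covariant link RP (axis `0`) of torus limit points.** For `β ≥ 0` and continuous `ρ`,
every infinite-volume limit point of the torus Wilson states has the covariant
(Osterwalder–Seiler half-link) link reflection positivity `IsCovariantLinkRP 0` of
`ZdCovariantLinkRP.lean`: the torus pairings are non-negative for all large tori of the defining
subsequence (`torus_cov_nonneg`, even and odd sides) and converge to `∫ Φ dμ`. -/
theorem covariantLinkRP_zero_of_mem_infiniteVolumeLimitPoints (hρ : Continuous ρ) {β : ℝ}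
    (hβ : 0 ≤ β) {μ : Measure (LGConfig d G)} (hμ : μ ∈ infiniteVolumeLimitPoints (d := d) ρ β) :
    IsCovariantLinkRP (0 : Fin d) μ := by
  intro n g T hT hgm hgT hgb Φ S hΦS hΦc hΦb hcov
  obtain ⟨φ, hφ, hprob, hconv⟩ := hμ
  haveI := hprob
  obtain ⟨Cg, hCg⟩ := hgb
  obtain ⟨C, hC⟩ := hΦb
  -- a common bound on the time coordinates of the supports
  obtain ⟨m, hSm, hTm⟩ : ∃ m : ℕ, (∀ e ∈ S, -(m : ℤ) ≤ e.1 0 ∧ e.1 0 ≤ m) ∧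
      ∀ e ∈ T, e.1 0 ≤ m := by
    refine ⟨(S ∪ T).sup fun e => (e.1 0).natAbs, fun e he => ?_, fun e he => ?_⟩
    · have h := Finset.le_sup (f := fun e : ZdEdge d => (e.1 0).natAbs) (Finset.mem_union_left T he)
      constructor <;> omega
    · have h := Finset.le_sup (f := fun e : ZdEdge d => (e.1 0).natAbs) (Finset.mem_union_right S he)
      omega
  -- real and imaginary parts converge along the defining subsequence
  have hre := hconv (fun U => (Φ U).re) S (fun U V h => by simp only [hΦS h])
    (Complex.continuous_re.comp hΦc) ⟨C, fun U => (Complex.abs_re_le_norm _).trans (hC U)⟩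
  have him := hconv (fun U => (Φ U).im) S (fun U V h => by simp only [hΦS h])
    (Complex.continuous_im.comp hΦc) ⟨C, fun U => (Complex.abs_im_le_norm _).trans (hC U)⟩
  -- the torus expectations are non-negative reals for large `k`
  have hev : ∀ᶠ k in atTop,
      0 ≤ wilsonExpectation (L := φ k + 1) ρ β (toTorusObservable (φ k + 1) fun U => (Φ U).re) ∧
      wilsonExpectation (L := φ k + 1) ρ β (toTorusObservable (φ k + 1) fun U => (Φ U).im) = 0 := by
    refine Filter.eventually_atTop.2 ⟨2 * m + 4, fun k hk => ?_⟩
    have hkφ : k ≤ φ k := hφ.le_apply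
    have hmL : m + 1 ≤ (φ k + 1) / 2 := by omega
    haveI := isProbabilityMeasure_wilsonMeasure (d := d) (L := φ k + 1) (G := G) ρ hρ β
    have hpos := torus_cov_nonneg ρ hρ hβ (L := φ k + 1) hT hgm hgT hCg hΦS hΦc.measurable hcov
      hSm hTm hmL
    have hint : Integrable (toTorusObservable (φ k + 1) Φ) (wilsonMeasure (L := φ k + 1) ρ β) :=
      Integrable.of_bound ((hΦc.comp (continuous_torusLift _)).measurable.aestronglyMeasurable)
        C (ae_of_all _ fun U => hC _)
    obtain ⟨h1, h2⟩ := Complex.nonneg_iff.1 hpos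
    have hre_eq : (wilsonExpectation (L := φ k + 1) ρ β (toTorusObservable (φ k + 1) Φ)).re =
        wilsonExpectation (L := φ k + 1) ρ β (toTorusObservable (φ k + 1) fun U => (Φ U).re) := by
      simp only [wilsonExpectation]
      exact (integral_re hint).symm
    have him_eq : (wilsonExpectation (L := φ k + 1) ρ β (toTorusObservable (φ k + 1) Φ)).im =
        wilsonExpectation (L := φ k + 1) ρ β (toTorusObservable (φ k + 1) fun U => (Φ U).im) := by
      simp only [wilsonExpectation]
      exact (integral_im hint).symm
    exact ⟨hre_eq ▸ h1, (him_eq ▸ h2).symm⟩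
  -- pass to the limit
  have hint : Integrable Φ μ :=
    Integrable.of_bound hΦc.measurable.aestronglyMeasurable C (ae_of_all _ fun U => hC _)
  have h1 : 0 ≤ ∫ U, (Φ U).re ∂μ := ge_of_tendsto hre (hev.mono fun k hk => hk.1)
  have h2 : ∫ U, (Φ U).im ∂μ = 0 := by
    refine tendsto_nhds_unique him ?_
    exact tendsto_const_nhds.congr' (hev.mono fun k hk => hk.2.symm)
  have hre' : (∫ U, Φ U ∂μ).re = ∫ U, (Φ U).re ∂μ := by
    have h := integral_re hint
    simp only [RCLike.re_to_complex] at h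
    exact h.symm
  have him' : (∫ U, Φ U ∂μ).im = ∫ U, (Φ U).im ∂μ := by
    have h := integral_im hint
    simp only [RCLike.im_to_complex] at h
    exact h.symm
  refine Complex.nonneg_iff.2 ⟨?_, ?_⟩
  · rw [hre']; exact h1
  · rw [him', h2]

end Limit

/-! ## Transport to every axis -/

section Transport

variable [SecondCountableTopology G]

omit [CompactSpace G] [IsTopologicalGroup G] in
/-- ★ **Transport of the covariant property under the transposition `(0 i)`**: if `μ` is
invariant under `configPerm (Equiv.swap 0 i)` and has `IsCovariantLinkRP 0`, then it has
`IsCovariantLinkRP i` (mirror, substitution and splice are conjugated, supports are permuted). -/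
theorem IsCovariantLinkRP.of_swap {μ : Measure (LGConfig d G)} (i : Fin d)
    (hπ : MeasurePreserving (configPerm (Equiv.swap 0 i)) μ μ) (h0 : IsCovariantLinkRP 0 μ) :
    IsCovariantLinkRP i μ := by
  classical
  intro n g T hT hgm hgT hgb Φ S hΦS hΦc hΦb hcov
  set π : LGConfig d G → LGConfig d G := configPerm (Equiv.swap 0 i) with hπdef
  have hππ : ∀ U, π (π U) = U := configPerm_swap_configPerm_swap i
  set ψ : ZdEdge d → ZdEdge d := fun e => (e.1 ∘ ⇑(Equiv.swap 0 i), (Equiv.swap 0 i).symm e.2)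
    with hψ
  -- the transported data
  have hgm' : ∀ k, Measurable (g k ∘ π) := fun k => (hgm k).comp hπ.measurable
  have hgT' : ∀ k, IsCylinder (g k ∘ π) (T.image ψ) := fun k => isCylinder_comp_configPerm (hgT k) _
  have hΦS' : IsCylinder (Φ ∘ π) (S.image ψ) := isCylinder_comp_configPerm hΦS _
  have hΦc' : Continuous (Φ ∘ π) := hΦc.comp (continuous_configPerm _)
  have hcov' : ∀ U Y, (Φ ∘ π) (configCrossTranslate 0 Y U) =
      ∑ k, (g k ∘ π) (configCrossSplice 0 U Y) * conj ((g k ∘ π) (configLinkReflect 0 U)) := by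
    intro U Y
    have h := hcov (π U) (π Y)
    rw [configCrossTranslate_eq_conj i, configCrossSplice_eq_conj i, configLinkReflect_eq_conj i]
      at h
    simp only [Function.comp_apply]
    simpa only [← hπdef, hππ] using h
  have h := h0 n (fun k => g k ∘ π) (T.image ψ) (image_subset_half_union_cross i hT) hgm' hgT'
    (hgb.imp fun C hC k U => hC k _) (Φ ∘ π) (S.image ψ) hΦS' hΦc' (hΦb.imp fun C hC U => hC _)
    hcov'
  have key : ∫ U, Φ (π U) ∂μ = ∫ U, Φ U ∂μ := by
    rw [← integral_map hπ.measurable.aemeasurable (hΦc.measurable.aestronglyMeasurable), hπ.map_eq]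
  calc (0 : ℂ) ≤ ∫ U, (Φ ∘ π) U ∂μ := h
    _ = ∫ U, Φ (π U) ∂μ := rfl
    _ = ∫ U, Φ U ∂μ := key

/-- ★★★ **Covariant link RP of torus limit points in EVERY link hyperplane `x_i = ½`**
(`β ≥ 0`, continuous `ρ`): every infinite-volume limit point of the torus Wilson states satisfies
`IsCovariantLinkRP i μ` for every axis `i` — the property that licenses Kazakov–Zheng's
link-type (cut-loop) positivity matrices for such states (`ClassBLinkCutWordBlocks.lean`). -/
theorem covariantLinkRP_of_mem_infiniteVolumeLimitPoints [T2Space G] (hρ : Continuous ρ) {β : ℝ}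
    (hβ : 0 ≤ β) {μ : Measure (LGConfig d G)} (hμ : μ ∈ infiniteVolumeLimitPoints (d := d) ρ β)
    (i : Fin d) : IsCovariantLinkRP i μ :=
  IsCovariantLinkRP.of_swap i (permInvariant_of_mem_infiniteVolumeLimitPoints ρ hρ hμ _)
    (covariantLinkRP_zero_of_mem_infiniteVolumeLimitPoints ρ hρ hβ hμ)

end Transport

end Summit.QuantumFields.GaugeBoot
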